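import Summits.HodgeConjecture.CorCM.AbelianCMFieldsOddPartClassification
import HarnessLib

/-!
# Abelian CM fields ALL of whose CM types are nondegenerate: exactly the cyclic fields of `2`-power degree

COR-CM (cell `pub-hodgecm2`), binder seat b04 (gen 18), count-neutral claim ABELIAN-ODD-PART, part VI (the imprimitive
companion).  KERNEL ONLY: theorems; no definition, no named fact, no `sorry`.  `HC_CM` is neither used nor claimed.

Gen 11 (`CyclicTwoPower.isNondegenerate_of_isCyclic`): if `Gal(K/ℚ)` is CYCLIC of order `2^{k+1}` then EVERY CM type of
`K` — primitive or not — is nondegenerate (so every abelian variety with CM by `K`, simple or not, satisfies the Hodge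
conjecture with all its powers).  This file proves the converse for abelian CM fields:

**Theorem (`forall_isNondegenerate_iff_isCyclic_two_power`).**  For a CM field `K`, Galois over `ℚ` with ABELIAN Galois
group: every CM type of `K` is nondegenerate **iff** `Gal(K/ℚ)` is cyclic of `2`-power order.

The mechanism is the classical one behind imprimitive types: a subgroup `H ≠ 1` of `Gal(K/ℚ)` avoiding complex
conjugation `c` (a proper CM subfield `K^H`) carries an `H`-invariant CM set (`exists_invariant_cmset`: one of the two
`H`-cosets in each coset of `H·⟨c⟩`), killed by any odd character non-trivial on `H` (`sum_eq_zero_of_mul_invariant`),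
hence a DEGENERATE CM type by Kubota's Lemma 2 (`exists_not_isNondegenerate_of_galoisFinset_char`); and a finite
commutative group in which every non-trivial subgroup contains the involution `c` is a cyclic `2`-group
(`exists_subgroup_not_mem`: an element of odd prime order, or a second involution, generates a subgroup avoiding `c`).

## References

* [Kubota1965] T. Kubota, *On the field extension by complex multiplication*, Trans. AMS 118 (1965), §4 Lemma 2.
* [Shimura1998] G. Shimura, *Abelian Varieties with Complex Multiplication and Modular Functions*, §8.1, §8.2.
* [Gordon1999HodgeAVSurvey] B. B. Gordon, *A survey of the Hodge conjecture for abelian varieties*, Prop. 9.4.1, 9.4.2.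
-/

noncomputable section

open CategoryTheory CategoryTheory.Limits NumberField

namespace Summit.HodgeConjecture.CorCM.AbelianOddPart

open Literature.NumberTheory.ComplexMultiplication
open Literature.AlgebraicGeometry.Motives (AbelianVariety CMType)
open Literature.AlgebraicGeometry.HodgeTheory
open Literature.AlgebraicGeometry.ComplexMultiplication (IsCMTypeRealisation exists_isCMTypeRealisation_of_realised)
open Literature.AlgebraicGeometry.Pohlmann1968
open Summit.HodgeConjecture.CorCM.GaloisOctic (complexConj_restrictScalars_ne_one complexConj_mul_self
  embOf_complexConj_mul)
open Summit.HodgeConjecture.CorCM.CyclicTwoPower (isNondegenerate_of_isCyclic)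

open scoped Classical

/-! ## §1 Group level: invariant CM sets, their vanishing sums, subgroups avoiding `c` -/

section Group

variable {G : Type*} [CommGroup G] [Fintype G]

omit [Fintype G] in
/-- The cyclic subgroup of an involution is `{1, c}`. [folklore] -/
theorem eq_one_or_eq_of_mem_zpowers {c z : G} (hcc : c * c = 1) (hz : z ∈ Subgroup.zpowers c) : z = 1 ∨ z = c := by
  obtain ⟨k, rfl⟩ := Subgroup.mem_zpowers_iff.1 hz
  have hc2 : c ^ (2 : ℤ) = 1 := by rw [zpow_two, hcc]
  rcases Int.even_or_odd k with ⟨j, hj⟩ | ⟨j, hj⟩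
  · left
    rw [hj, ← two_mul, zpow_mul, hc2, one_zpow]
  · right
    rw [hj, zpow_add, zpow_mul, hc2, one_zpow, one_mul, zpow_one]

omit [Fintype G] in
/-- `H ⊔ ⟨c⟩ = H ∪ cH` for an involution `c` in a commutative group. [folklore] -/
theorem mem_or_mul_mem_of_mem_sup (H : Subgroup G) {c x : G} (hcc : c * c = 1)
    (hx : x ∈ H ⊔ Subgroup.zpowers c) : x ∈ H ∨ c * x ∈ H := by
  obtain ⟨y, hy, z, hz, rfl⟩ := Subgroup.mem_sup.1 hx
  rcases eq_one_or_eq_of_mem_zpowers hcc hz with rfl | rfl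
  · exact Or.inl (by rw [mul_one]; exact hy)
  · refine Or.inr ?_
    rw [mul_left_comm, hcc, mul_one]
    exact hy

/-- **An `H`-invariant CM set for `c ∉ H`**: in each coset of `K = H·⟨c⟩ = H ∪ cH` choose the `H`-coset of a fixed
representative; the resulting `T ⊆ G` contains exactly one of `g, cg` for every `g` and is stable under right
multiplication by `H` (it is a CM type lifted from the CM "subfield" `G/H`). [cite: Shimura1998, §8.1] -/
theorem exists_invariant_cmset (H : Subgroup G) {c : G} (hcc : c * c = 1) (hcH : c ∉ H) :
    ∃ T : Finset G, (∀ g : G, g ∈ T ↔ c * g ∉ T) ∧ ∀ g : G, ∀ h ∈ H, g * h ∈ T ↔ g ∈ T := by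
  set K : Subgroup G := H ⊔ Subgroup.zpowers c with hK
  have hHK : H ≤ K := le_sup_left
  have hcK : c ∈ K := (le_sup_right : Subgroup.zpowers c ≤ K) (Subgroup.mem_zpowers c)
  set rep : G ⧸ K → G := fun q => Quotient.out q with hrep_def
  have hrep : ∀ q : G ⧸ K, ((rep q : G) : G ⧸ K) = q := fun q => QuotientGroup.out_eq' q
  have hrg : ∀ g : G, (rep (g : G ⧸ K))⁻¹ * g ∈ K := fun g => QuotientGroup.eq.1 (hrep _)
  set T : Finset G := Finset.univ.filter fun g : G => (rep (g : G ⧸ K))⁻¹ * g ∈ H with hT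
  have hmem : ∀ g : G, g ∈ T ↔ (rep (g : G ⧸ K))⁻¹ * g ∈ H := fun g => by
    simp only [hT, Finset.mem_filter, Finset.mem_univ, true_and]
  refine ⟨T, fun g => ?_, fun g h hh => ?_⟩
  · have hq : ((c * g : G) : G ⧸ K) = (g : G ⧸ K) := by
      rw [QuotientGroup.mk_mul, (QuotientGroup.eq_one_iff c).2 hcK, one_mul]
    rw [hmem, hmem, hq, mul_left_comm]
    set x := (rep (g : G ⧸ K))⁻¹ * g with hx
    constructor
    · intro hxH hcx
      have h := H.mul_mem hcx (H.inv_mem hxH)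
      rw [mul_inv_cancel_right] at h
      exact hcH h
    · intro hcx
      rcases mem_or_mul_mem_of_mem_sup H hcc (hrg g) with h | h
      · exact h
      · exact absurd h hcx
  · have hq : ((g * h : G) : G ⧸ K) = (g : G ⧸ K) := by
      rw [QuotientGroup.mk_mul, (QuotientGroup.eq_one_iff h).2 (hHK hh), mul_one]
    rw [hmem, hmem, hq, ← mul_assoc]
    exact ⟨fun h' => by simpa using H.mul_mem h' (H.inv_mem hh), fun h' => H.mul_mem h' hh⟩

omit [Fintype G] in
/-- **A character non-trivial on a right-stabiliser kills the set**: if `T·h₀ = T` and `χ(h₀) ≠ 1` then `Σ_T χ = 0`.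
[cite: Kubota1965, §4 Lemma 2 (proof)] -/
theorem sum_eq_zero_of_mul_invariant (T : Finset G) {h₀ : G} (hT : ∀ g : G, g * h₀ ∈ T ↔ g ∈ T)
    (χ : AddChar (Additive G) ℂ) (hχ : χ (Additive.ofMul h₀) ≠ 1) : ∑ g ∈ T, χ (Additive.ofMul g) = 0 := by
  set S := ∑ g ∈ T, χ (Additive.ofMul g) with hS
  have hre : S * χ (Additive.ofMul h₀) = S := by
    rw [hS, Finset.sum_mul]
    refine Finset.sum_nbij' (fun g => g * h₀) (fun g => g * h₀⁻¹) ?_ ?_ ?_ ?_ ?_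
    · intro g hg; exact (hT g).2 hg
    · intro g hg
      have h := (hT (g * h₀⁻¹)).1
      rw [inv_mul_cancel_right] at h
      exact h hg
    · intro g _; rw [mul_inv_cancel_right]
    · intro g _; rw [inv_mul_cancel_right]
    · intro g _; rw [ofMul_mul, AddChar.map_add_eq_mul]
  have h1 : S * (χ (Additive.ofMul h₀) - 1) = 0 := by rw [mul_sub, hre, mul_one, sub_self]
  rcases mul_eq_zero.1 h1 with h | h
  · exact h
  · exact absurd (sub_eq_zero.1 h) hχ

/-- **A finite commutative group whose non-trivial subgroups all contain the involution `c` is a cyclic `2`-group**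
(contrapositive: an element of odd prime order — Cauchy — or a second involution — prime-wise counting criterion —
generates a subgroup avoiding `c`). [folklore] -/
theorem exists_subgroup_not_mem {c : G} (hc1 : c ≠ 1) (hcc : c * c = 1)
    (h : ¬ (IsCyclic G ∧ ∃ k : ℕ, Fintype.card G = 2 ^ k)) :
    ∃ H : Subgroup G, H ≠ ⊥ ∧ c ∉ H := by
  have hordc : orderOf c = 2 := orderOf_eq_prime (by rw [pow_two, hcc]) hc1
  by_cases hodd : ∃ q : ℕ, q.Prime ∧ q ∣ Fintype.card G ∧ q ≠ 2
  · -- an element `u` of odd prime order: `c ∉ ⟨u⟩`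
    obtain ⟨q, hq, hqG, hq2⟩ := hodd
    haveI : Fact q.Prime := ⟨hq⟩
    obtain ⟨u, hu⟩ := exists_prime_orderOf_dvd_card q hqG
    refine ⟨Subgroup.zpowers u, fun hbot => ?_, fun hcu => ?_⟩
    · have hu1 : u = 1 := by
        have := Subgroup.mem_zpowers u
        rw [hbot] at this
        exact Subgroup.mem_bot.1 this
      rw [hu1, orderOf_one] at hu
      exact hq.one_lt.ne hu
    · have hdvd : orderOf c ∣ orderOf u := orderOf_dvd_of_mem_zpowers hcu
      rw [hordc, hu] at hdvd
      exact hq2 ((Nat.prime_dvd_prime_iff_eq Nat.prime_two hq).1 hdvd).symm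
  · -- `|G|` is a power of `2` and `G` is not cyclic: a second involution
    push Not at hodd
    have hcard0 : Fintype.card G ≠ 0 := Fintype.card_ne_zero
    have h2pow : Fintype.card G = 2 ^ (Fintype.card G).primeFactorsList.length :=
      Nat.eq_prime_pow_of_unique_prime_dvd hcard0 fun {d} hd hdG => by
        by_contra hne
        exact hne (by have := hodd d hd hdG; tauto)
    have hnc : ¬ IsCyclic G := fun hcyc => h ⟨hcyc, _, h2pow⟩
    obtain ⟨p, hp, hlt⟩ := exists_prime_card_lt_of_not_isCyclic hnc
    -- `p = 2`: an element of odd prime order would have order dividing `2^k`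
    have hp2 : p = 2 := by
      by_contra hp2
      have hlt1 : ({1} : Finset G).card < (Finset.univ.filter fun x : G => x ^ p = 1).card := by
        rw [Finset.card_singleton]; exact lt_trans hp.one_lt hlt
      obtain ⟨x, hxS, hx1⟩ := Finset.exists_mem_notMem_of_card_lt_card hlt1
      rw [Finset.mem_singleton] at hx1
      simp only [Finset.mem_filter, Finset.mem_univ, true_and] at hxS
      haveI : Fact p.Prime := ⟨hp⟩
      have hox : orderOf x = p := orderOf_eq_prime hxS hx1
      have hdvd : p ∣ 2 ^ (Fintype.card G).primeFactorsList.length := by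
        rw [← hox, ← h2pow]; exact orderOf_dvd_card
      exact hp2 ((Nat.prime_dvd_prime_iff_eq hp Nat.prime_two).1 (hp.dvd_of_dvd_pow hdvd))
    subst hp2
    have hlt' : ({1, c} : Finset G).card < (Finset.univ.filter fun x : G => x ^ 2 = 1).card :=
      lt_of_le_of_lt Finset.card_le_two hlt
    obtain ⟨t, htS, ht⟩ := Finset.exists_mem_notMem_of_card_lt_card hlt'
    simp only [Finset.mem_insert, Finset.mem_singleton, not_or] at ht
    simp only [Finset.mem_filter, Finset.mem_univ, true_and] at htS
    have htt : t * t = 1 := by rw [← pow_two]; exact htS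
    refine ⟨Subgroup.zpowers t, fun hbot => ht.1 ?_, fun hct => ?_⟩
    · have := Subgroup.mem_zpowers t
      rw [hbot] at this
      exact Subgroup.mem_bot.1 this
    · rcases eq_one_or_eq_of_mem_zpowers htt hct with h1 | h2
      · exact hc1 h1
      · exact ht.2 h2.symm

end Group

/-! ## §2 Abelian CM fields -/

section Field

variable {K : Type} [Field K] [NumberField K] [IsCMField K]

/-- **CM sets on `Gal(K/ℚ)` killed by an odd character ⟹ DEGENERATE CM types** (no primitivity asked; `K/ℚ` Galois
CM with commutative Galois group; Kubota's Lemma 2). [cite: Kubota1965, §4 Lemma 2] [cite: Shimura1998, §8.1] -/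
theorem exists_not_isNondegenerate_of_galoisFinset_char [IsGalois ℚ K]
    (hcomm : ∀ g h : K ≃ₐ[ℚ] K, g * h = h * g) (T : Finset (K ≃ₐ[ℚ] K))
    (hcm : ∀ g : K ≃ₐ[ℚ] K, g ∈ T ↔ (IsCMField.complexConj K).restrictScalars ℚ * g ∉ T)
    (χ : AddChar (Additive (K ≃ₐ[ℚ] K)) ℂ)
    (hχc : χ (Additive.ofMul ((IsCMField.complexConj K).restrictScalars ℚ)) = -1)
    (hχT : ∑ g ∈ T, χ (Additive.ofMul g) = 0) (φ₀ : K →+* ℂ) :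
    ∃ Φ : CMType K, ¬ IsNondegenerate Φ ∧ ∀ g : K ≃ₐ[ℚ] K, embOf φ₀ g ∈ Φ.1 ↔ g ∈ T := by
  set c : K ≃ₐ[ℚ] K := (IsCMField.complexConj K).restrictScalars ℚ with hc_def
  have hEinj : Function.Injective (embOf φ₀) := (embOf_bijective φ₀).1
  have hEsurj : Function.Surjective (embOf φ₀) := (embOf_bijective φ₀).2
  set S : Set (K →+* ℂ) := embOf φ₀ '' (T : Set (K ≃ₐ[ℚ] K)) with hS_def
  have hmemE : ∀ g, embOf φ₀ g ∈ S ↔ g ∈ T := fun g => by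
    rw [hS_def, hEinj.mem_set_image, Finset.mem_coe]
  have hcm' : ∀ φ, φ ∈ S ↔ ComplexEmbedding.conjugate φ ∉ S := by
    intro φ
    obtain ⟨g, rfl⟩ := hEsurj φ
    rw [← embOf_complexConj_mul, hmemE, hmemE]
    exact hcm g
  let Φ : CMType K := ⟨S, hcm'⟩
  refine ⟨Φ, ?_, fun g => hmemE g⟩
  rw [isNondegenerate_iff_forall_oddCharacters hcomm Φ φ₀ c (apply_complexConj_eq_conj φ₀), not_forall]
  refine ⟨χ, fun h => h hχc ?_⟩
  have hfilter : (Finset.univ.filter fun g : K ≃ₐ[ℚ] K => embOf φ₀ g ∈ Φ.1) = T := by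
    ext g
    simp only [Finset.mem_filter, Finset.mem_univ, true_and]
    exact hmemE g
  rw [hfilter, hχT]

/-- **A proper CM subfield forces a degenerate type**: if a subgroup `H ≠ 1` of the (commutative) Galois group avoids
complex conjugation, the CM types lifted from `K^H` are DEGENERATE (`rank ≤ [K^H:ℚ]/2 + 1`; here: an odd character
non-trivial on `H` kills the `H`-invariant set). [cite: Kubota1965, §4 Lemma 2] [cite: Shimura1998, §8.2] -/
theorem exists_not_isNondegenerate_of_subgroup [IsGalois ℚ K] (hcomm : ∀ g h : K ≃ₐ[ℚ] K, g * h = h * g)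
    (H : Subgroup (K ≃ₐ[ℚ] K)) (hH : H ≠ ⊥) (hcH : (IsCMField.complexConj K).restrictScalars ℚ ∉ H) :
    ∃ Φ : CMType K, ¬ IsNondegenerate Φ := by
  letI : CommGroup (K ≃ₐ[ℚ] K) := { (inferInstance : Group (K ≃ₐ[ℚ] K)) with mul_comm := hcomm }
  set c : K ≃ₐ[ℚ] K := (IsCMField.complexConj K).restrictScalars ℚ with hc
  obtain ⟨φ₀⟩ := (inferInstance : Nonempty (K →+* ℂ))
  obtain ⟨T, hcm, hinv⟩ := exists_invariant_cmset H complexConj_mul_self hcH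
  -- some `h₀ ∈ H`, `h₀ ≠ 1`, and an odd character non-trivial at `h₀`
  obtain ⟨h₀, hh₀H, hh₀⟩ : ∃ h₀ ∈ H, h₀ ≠ 1 := by
    by_contra hne
    push Not at hne
    exact hH ((Subgroup.eq_bot_iff_forall H).2 hne)
  obtain ⟨χ, hχc, hχh⟩ := exists_oddCharacter_apply_ne_one (complexConj_restrictScalars_ne_one (K := K))
    complexConj_mul_self hh₀
  have hsum := sum_eq_zero_of_mul_invariant T (fun g => hinv g h₀ hh₀H) χ hχh
  obtain ⟨Φ, hdeg, -⟩ := exists_not_isNondegenerate_of_galoisFinset_char hcomm T hcm χ hχc hsum φ₀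
  exact ⟨Φ, hdeg⟩

/-- **THE IMPRIMITIVE COMPANION.**  `K` CM, Galois over `ℚ` with ABELIAN Galois group: EVERY CM type of `K` is
nondegenerate **iff** `Gal(K/ℚ)` is CYCLIC of `2`-POWER order (⟸ gen 11: the odd characters of a cyclic `2`-group are
faithful; ⟹: otherwise a non-trivial subgroup avoids `c`).  Equivalently: every abelian variety with complex
multiplication by `K` (of any CM type) is nondegenerate iff `K` is cyclic of `2`-power degree.
[cite: Kubota1965, §4 Lemma 2] [cite: Gordon1999HodgeAVSurvey, Prop. 9.4.1] -/
theorem forall_isNondegenerate_iff_isCyclic_two_power [IsGalois ℚ K] (hcomm : ∀ g h : K ≃ₐ[ℚ] K, g * h = h * g) :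
    (∀ Φ : CMType K, IsNondegenerate Φ) ↔
      IsCyclic (K ≃ₐ[ℚ] K) ∧ ∃ k : ℕ, Module.finrank ℚ K = 2 ^ (k + 1) := by
  letI : CommGroup (K ≃ₐ[ℚ] K) := { (inferInstance : Group (K ≃ₐ[ℚ] K)) with mul_comm := hcomm }
  have hcardK : Fintype.card (K ≃ₐ[ℚ] K) = Module.finrank ℚ K := by
    rw [← Nat.card_eq_fintype_card, IsGalois.card_aut_eq_finrank]
  constructor
  · intro hall
    by_contra hnot
    have h' : ¬ (IsCyclic (K ≃ₐ[ℚ] K) ∧ ∃ k : ℕ, Fintype.card (K ≃ₐ[ℚ] K) = 2 ^ k) := by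
      rintro ⟨hcyc, k, hk⟩
      apply hnot
      refine ⟨hcyc, ?_⟩
      -- `k ≥ 1` since `c ≠ 1`
      rcases Nat.eq_zero_or_pos k with h0 | hpos
      · rw [h0, pow_zero] at hk
        have h2 : 2 ≤ Fintype.card (K ≃ₐ[ℚ] K) := by
          have : ({1, (IsCMField.complexConj K).restrictScalars ℚ} : Finset (K ≃ₐ[ℚ] K)).card = 2 :=
            Finset.card_pair (complexConj_restrictScalars_ne_one (K := K)).symm
          rw [← this]
          exact Finset.card_le_univ _
        omega
      · exact ⟨k - 1, by rw [← hcardK, hk]; congr 1; omega⟩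
    obtain ⟨H, hH, hcH⟩ := exists_subgroup_not_mem (complexConj_restrictScalars_ne_one (K := K))
      complexConj_mul_self h'
    obtain ⟨Φ, hdeg⟩ := exists_not_isNondegenerate_of_subgroup hcomm H hH hcH
    exact hdeg (hall Φ)
  · rintro ⟨hcyc, k, hK⟩ Φ
    exact isNondegenerate_of_isCyclic hcyc hK Φ

/-- **The same on abelian varieties**: every abelian variety with complex multiplication by the abelian CM field `K`
(any CM type, simple or not) is nondegenerate — hence satisfies the Hodge conjecture with all its powers — iff
`Gal(K/ℚ)` is cyclic of `2`-power order (`ℚ(ζ_5)`, `ℚ(ζ_{16})`, `ℚ(ζ_{17})`, `ℚ(ζ_{32} − ζ_{32}^{-1})`, …); every other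
abelian CM field has a CM abelian variety (realising a lifted type) with an exceptional Hodge class on a power.
[cite: Shimura1998, §6.2 Thm. 3] [cite: Gordon1999HodgeAVSurvey, Thm. 6.4 and Prop. 9.4.1] -/
theorem forall_realisation_isNondegenerate_iff [IsGalois ℚ K] (hcomm : ∀ g h : K ≃ₐ[ℚ] K, g * h = h * g) :
    (∀ (Φ : CMType K) (A : AbelianVariety ℂ) (ι : 𝓞 K →+* End A) (θ : K →+* Module.End ℂ (complexBetti A.X 1)),
        IsCMTypeRealisation Φ A ι θ → IsNondegenerate Φ) ↔
      IsCyclic (K ≃ₐ[ℚ] K) ∧ ∃ k : ℕ, Module.finrank ℚ K = 2 ^ (k + 1) := by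
  rw [← forall_isNondegenerate_iff_isCyclic_two_power hcomm]
  constructor
  · intro h Φ
    obtain ⟨A, ι, θ, hA⟩ := exists_isCMTypeRealisation_of_realised cmAbelianVarietyRealised_holds K Φ
    exact h Φ A ι θ hA
  · intro h Φ A ι θ _
    exact h Φ

end Field

end Summit.HodgeConjecture.CorCM.AbelianOddPart

end
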